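import Summits.ValiantsHypothesis.ValiantsHypothesis.Theorems.SymPencilSingSixClassificationTransport

/-!
# Route `SymPencil` — SING-SIX CLASSIFICATION, Theorem A (T6′): every `6`-dimensional linear
# subspace of `Sing Z(per₄)` lies in a cross, has two zero rows / columns, or is an exotic
# one-zero-line family `V_λ`, `V^gr` (ᵀ) — VERBATIM port, part 3/10 (`--supports`
# stmt-ValiantsHypothesis-5674 `SdcSuperquadratic`; rung currency only, nothing here bears on `VP ≠ VNP`)

PORT NOTE (val-width-5674-w2 g0′, helper mode; director-valiant R223 (a)): part 3/10 of a VERBATIM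
port of val-idea-18 g3/g4's SORRY-FREE Theorem A of `Cruxes/SdcSuperquadratic/Lines/
sing_six_classification.lean` rev 2.6 (sha256 dfb5f805c61d14b7…; here: `casePure_of` … `graphCond_sub`).
ALL mathematics and proofs are val-idea-18's (memo `SING-SIX-CLASSIFICATION.md`); the port changes
only the file split, the linear import chain, the namespace, and one-line docstrings on API lemmas.
NOT ported: the `sorry`-stubs of LIST leaves 3–5 and `sixDim_perDir_list` (leaves 3, 4 = landed
`SymPencilPerFourExoticNoSixSquares` / `SymPencilPerFourCrossFilter`; leaf 5 open).
  Cut table: see part 1 (`…Defs`).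
Honest label: Theorem A of a line, not the crux, not the LIST; `27 ≤ sdc(per₄) ≤ 29` unchanged; stmt-5674
open; `VP ≠ VNP` not moved; no summit statement is proved here. [folklore]
-/

noncomputable section
set_option linter.dupNamespace false
set_option linter.unusedVariables false
set_option linter.unusedSectionVars false

namespace Summit.ValiantsHypothesis.ValiantsHypothesis.Theorems.SymPencilSingSixClassification

open MvPolynomial Module Literature.Computability.AlgebraicComplexity
open Literature.Barriers.CriticalPhenomena.Haruspicy (fin4_cases)
variable {K : Type*} [Field K]

/-- **§3.6 (i) PURE KERNEL PLANE — PROVED** (rev 2.2; was `stub_casePure`): a linear section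
`u ↦ g u` of `row_{ρ1} : W → K⁴`, `φ u = row_{ρ2} (g u)`, `B = row_{ρ3} (K_r)` (`2`-dimensional since
rows `0, ρ 1, ρ 2` vanish on `K_r`), the `Sing3` identity `T3 (u, φ u, b) = 0` on `g u + k`, and
`PureCore` give `φ = 0`; then `x - g (row_{ρ1} x) ∈ K_r`. -/
theorem casePure_of [CharZero K] (hC : PureCore K) : CasePure K := by
  intro W ρ hN hρ htop hKs
  obtain ⟨hS, h6, h0⟩ := hN
  have h12 : ρ 1 ≠ ρ 2 := fun h => by simpa using ρ.injective h
  have h13 : ρ 1 ≠ ρ 3 := fun h => by simpa using ρ.injective h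
  have h23 : ρ 2 ≠ ρ 3 := fun h => by simpa using ρ.injective h
  -- a linear section of `row_{ρ 1} : W → K⁴`
  obtain ⟨g, hg⟩ := LinearMap.exists_rightInverse_of_surjective
    ((rowL (K := K) (ρ 1)).domRestrict W) (by rw [LinearMap.range_domRestrict, htop])
  have hsec : ∀ u, row ((g u : W) : Fin 4 × Fin 4 → K) (ρ 1) = u := fun u => by
    have := LinearMap.congr_fun hg u
    simpa [rowL_apply] using this
  set φ : (Fin 4 → K) →ₗ[K] (Fin 4 → K) := (rowL (K := K) (ρ 2)).comp (W.subtype.comp g) with hφ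
  have hφu : ∀ u, φ u = row ((g u : W) : Fin 4 × Fin 4 → K) (ρ 2) := fun u => rfl
  set D : Submodule K (Fin 4 × Fin 4 → K) := W ⊓ LinearMap.ker (rowL (K := K) (ρ 1)) with hD
  have hD2 : finrank K D = 2 := finrank_kerPlane h6 htop
  -- on `D` the rows `0, ρ 1, ρ 2` vanish, so `row_{ρ 3}` is injective on `D`
  have hDrows : ∀ d ∈ D, ∀ i, i ≠ ρ 3 → row d i = 0 := by
    intro d hd i hi3
    rw [mem_kerPlane] at hd
    rcases fin4_of_perm ρ i with rfl | rfl | rfl | rfl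
    · rw [hρ]; exact h0 d hd.1
    · exact hd.2
    · exact hKs d hd.1 hd.2
    · exact absurd rfl hi3
  have hinj : ∀ d ∈ D, row d (ρ 3) = 0 → d = 0 := by
    intro d hd h3
    funext ⟨i, j⟩
    by_cases hi : i = ρ 3
    · subst hi; exact congrFun h3 j
    · exact congrFun (hDrows d hd i hi) j
  set B : Submodule K (Fin 4 → K) := D.map (rowL (K := K) (ρ 3)) with hB
  have hB2 : 2 ≤ finrank K B := by
    have hrn := LinearMap.finrank_range_add_finrank_ker ((rowL (K := K) (ρ 3)).domRestrict D)
    have hker : LinearMap.ker ((rowL (K := K) (ρ 3)).domRestrict D) = ⊥ := by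
      refine LinearMap.ker_eq_bot'.mpr fun d hd => ?_
      apply Subtype.ext
      exact hinj d d.2 (by simpa [rowL_apply] using hd)
    rw [LinearMap.range_domRestrict, hker, finrank_bot, hD2] at hrn
    rw [hB]; omega
  -- the key identity `T3 (u, φ u, b) = 0` for `b ∈ B` (the `Sing3` condition on `g u + k`)
  have hkey : ∀ u, ∀ b ∈ B, ∀ l, T3 u (φ u) b l = 0 := by
    intro u b hb l
    obtain ⟨k, hkD, rfl⟩ := Submodule.mem_map.mp hb
    have hkD' := hkD
    rw [mem_kerPlane] at hkD'
    obtain ⟨hkW, hk1⟩ := hkD'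
    have hk2 : row k (ρ 2) = 0 := hKs k hkW hk1
    have hxW : ((g u : W) : Fin 4 × Fin 4 → K) ∈ W := (g u).2
    have e0 := T3_eq_zero_of_sing3 hS hxW (ρ 1) (ρ 2) (ρ 3) h12 h13 h23 l
    have e1 := T3_eq_zero_of_sing3 hS (W.add_mem hxW hkW) (ρ 1) (ρ 2) (ρ 3) h12 h13 h23 l
    rw [row_add, row_add, row_add, hk1, hk2, add_zero, add_zero, T3_add₃, e0, zero_add,
      hsec u] at e1
    rw [hφu, rowL_apply]
    exact e1
  have hφ0 : φ = 0 := hC φ B hB2 hkey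
  intro x hx
  have hgW : ((g (row x (ρ 1)) : W) : Fin 4 × Fin 4 → K) ∈ W := (g (row x (ρ 1))).2
  have hkW := W.sub_mem hx hgW
  have hk1 : row (x - ((g (row x (ρ 1)) : W) : Fin 4 × Fin 4 → K)) (ρ 1) = 0 := by
    rw [row_sub, hsec, sub_self]
  have hk2 := hKs _ hkW hk1
  rw [row_sub, sub_eq_zero] at hk2
  rw [hk2, ← hφu, hφ0, LinearMap.zero_apply]

/-! #### Helpers for the `n_r = 4` cases (rev 2.3) -/

/-- The array with row `r` equal to `v` and all other rows zero. -/
def rowAt (r : Fin 4) (v : Fin 4 → K) : Fin 4 × Fin 4 → K :=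
  fun p => if p.1 = r then v p.2 else 0

/-- Auxiliary: `row_rowAt_self` (val-idea-18, SING-SIX classification). [folklore] -/
theorem row_rowAt_self (r : Fin 4) (v : Fin 4 → K) : row (rowAt r v) r = v := by
  funext j; simp [row, rowAt]

/-- Auxiliary: `row_rowAt_ne` (val-idea-18, SING-SIX classification). [folklore] -/
theorem row_rowAt_ne {r i : Fin 4} (h : i ≠ r) (v : Fin 4 → K) : row (rowAt r v) i = 0 := by
  funext j; simp [row, rowAt, h]

/-- Auxiliary: `lvec_apply` (val-idea-18, SING-SIX classification). [folklore] -/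
theorem lvec_apply (j c : Fin 4) (α β : K) (i : Fin 4) :
    lvec j c α β i = (if i = j then α else 0) + (if i = c then β else 0) := by
  simp [lvec, Pi.single_apply]

/-- Auxiliary: `lvec_apply_left` (val-idea-18, SING-SIX classification). [folklore] -/
theorem lvec_apply_left {j c : Fin 4} (hjc : j ≠ c) (α β : K) : lvec j c α β j = α := by
  simp [lvec_apply, hjc]

/-- Auxiliary: `lvec_apply_right` (val-idea-18, SING-SIX classification). [folklore] -/
theorem lvec_apply_right {j c : Fin 4} (hjc : j ≠ c) (α β : K) : lvec j c α β c = β := by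
  simp [lvec_apply, hjc.symm]

/-- Auxiliary: `lvec_apply_of_ne` (val-idea-18, SING-SIX classification). [folklore] -/
theorem lvec_apply_of_ne {i j c : Fin 4} (hij : i ≠ j) (hic : i ≠ c) (α β : K) :
    lvec j c α β i = 0 := by
  simp [lvec_apply, hij, hic]

omit [Field K] in
/-- A permutation of `Fin 4` taking `0 ↦ j`, `1 ↦ c`. -/
theorem exists_perm_zero_one {j c : Fin 4} (hjc : j ≠ c) :
    ∃ γ : Equiv.Perm (Fin 4), γ 0 = j ∧ γ 1 = c := by
  refine ⟨(Equiv.swap (0 : Fin 4) j).trans (Equiv.swap (Equiv.swap (0 : Fin 4) j 1) c), ?_, ?_⟩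
  · have h1 : j ≠ Equiv.swap (0 : Fin 4) j 1 := by
      intro h
      have h' : Equiv.swap (0 : Fin 4) j 0 = Equiv.swap (0 : Fin 4) j 1 := by
        rw [Equiv.swap_apply_left]; exact h
      exact absurd ((Equiv.swap (0 : Fin 4) j).injective h') (by decide)
    rw [Equiv.trans_apply, Equiv.swap_apply_left, Equiv.swap_apply_of_ne_of_ne h1 hjc]
  · rw [Equiv.trans_apply, Equiv.swap_apply_left]

/-- The values of `lvec j c α β` read through a permutation `γ` with `γ 0 = j`, `γ 1 = c`. -/
theorem lvec_perm {j c : Fin 4} (hjc : j ≠ c) {γ : Equiv.Perm (Fin 4)} (hγ0 : γ 0 = j)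
    (hγ1 : γ 1 = c) (α β : K) (i : Fin 4) : lvec j c α β (γ i) = ![α, β, 0, 0] i := by
  have hγ2j : γ 2 ≠ j := by rw [← hγ0]; exact fun h => by simpa using γ.injective h
  have hγ2c : γ 2 ≠ c := by rw [← hγ1]; exact fun h => by simpa using γ.injective h
  have hγ3j : γ 3 ≠ j := by rw [← hγ0]; exact fun h => by simpa using γ.injective h
  have hγ3c : γ 3 ≠ c := by rw [← hγ1]; exact fun h => by simpa using γ.injective h
  rcases fin4_cases i with rfl | rfl | rfl | rfl
  · rw [hγ0, lvec_apply_left hjc]; simp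
  · rw [hγ1, lvec_apply_right hjc]; simp
  · rw [lvec_apply_of_ne hγ2j hγ2c]; simp
  · rw [lvec_apply_of_ne hγ3j hγ3c]; simp

/-- A linear section of `row_r : W → K⁴` when `n_r = 4`. -/
theorem exists_rowSection {W : Submodule K (Fin 4 × Fin 4 → K)} {r : Fin 4}
    (htop : W.map (rowL r) = ⊤) :
    ∃ g : (Fin 4 → K) →ₗ[K] W, ∀ u, row ((g u : W) : Fin 4 × Fin 4 → K) r = u := by
  obtain ⟨g, hg⟩ := LinearMap.exists_rightInverse_of_surjective
    ((rowL (K := K) r).domRestrict W) (by rw [LinearMap.range_domRestrict, htop])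
  exact ⟨g, fun u => by simpa [rowL_apply] using LinearMap.congr_fun hg u⟩

/-- **§3.6 (ii) PRODUCT KERNEL PLANE — PROVED** (rev 2.3; was `stub_caseProduct`): section `g` of
`row_{ρ1}`, the `t¹`-coefficients of `Sing3` along the two generators `(0;0;a;0)`, `(0;0;0;b)` of
`K_r`, `ProductAbsorb` twice (`χ u ∈ K b`, `φ u ∈ K a`), absorption into `K_r`; then `V_λ` for
`αβ ≠ 0` and a cross for `αβ = 0`. -/
theorem caseProduct_of [CharZero K] (hPA : ProductAbsorb K) : CaseProduct K := by
  intro W ρ j c α β hN hρ htop hjc hαβ hK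
  obtain ⟨hS, h6, h0⟩ := hN
  have h12 : ρ 1 ≠ ρ 2 := fun h => by simpa using ρ.injective h
  have h13 : ρ 1 ≠ ρ 3 := fun h => by simpa using ρ.injective h
  have h23 : ρ 2 ≠ ρ 3 := fun h => by simpa using ρ.injective h
  obtain ⟨g, hsec⟩ := exists_rowSection htop
  have hgW : ∀ u, ((g u : W) : Fin 4 × Fin 4 → K) ∈ W := fun u => (g u).2
  set φ : (Fin 4 → K) →ₗ[K] (Fin 4 → K) := (rowL (K := K) (ρ 2)).comp (W.subtype.comp g) with hφ
  set χ : (Fin 4 → K) →ₗ[K] (Fin 4 → K) := (rowL (K := K) (ρ 3)).comp (W.subtype.comp g) with hχ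
  have hφu : ∀ u, φ u = row ((g u : W) : Fin 4 × Fin 4 → K) (ρ 2) := fun u => rfl
  have hχu : ∀ u, χ u = row ((g u : W) : Fin 4 × Fin 4 → K) (ρ 3) := fun u => rfl
  -- the two generators of `K_r`
  have hka : rowAt (ρ 2) (lvec j c α β) ∈ W ∧ row (rowAt (ρ 2) (lvec j c α β)) (ρ 1) = 0 := by
    refine (hK _).mpr ⟨fun i hi2 hi3 => row_rowAt_ne hi2 _, ⟨1, ?_⟩, ⟨0, ?_⟩⟩
    · rw [row_rowAt_self, one_smul]
    · rw [row_rowAt_ne h23.symm, zero_smul]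
  have hkb : rowAt (ρ 3) (lvec j c α (-β)) ∈ W ∧
      row (rowAt (ρ 3) (lvec j c α (-β))) (ρ 1) = 0 := by
    refine (hK _).mpr ⟨fun i hi2 hi3 => row_rowAt_ne hi3 _, ⟨0, ?_⟩, ⟨1, ?_⟩⟩
    · rw [row_rowAt_ne h23, zero_smul]
    · rw [row_rowAt_self, one_smul]
  -- `t¹`-coefficients of `Sing3` along the two generators
  have hTa : ∀ u l, T3 u (lvec j c α β) (χ u) l = 0 := by
    intro u l
    have e0 := T3_eq_zero_of_sing3 hS (hgW u) (ρ 1) (ρ 2) (ρ 3) h12 h13 h23 l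
    have e1 := T3_eq_zero_of_sing3 hS (W.add_mem (hgW u) hka.1) (ρ 1) (ρ 2) (ρ 3) h12 h13 h23 l
    rw [row_add, row_add, row_add, hka.2, row_rowAt_self, row_rowAt_ne h23.symm, add_zero,
      add_zero, T3_add₂, e0, zero_add, hsec u] at e1
    rw [hχu]; exact e1
  have hTb : ∀ u l, T3 u (lvec j c α (-β)) (φ u) l = 0 := by
    intro u l
    have e0 := T3_eq_zero_of_sing3 hS (hgW u) (ρ 1) (ρ 2) (ρ 3) h12 h13 h23 l
    have e1 := T3_eq_zero_of_sing3 hS (W.add_mem (hgW u) hkb.1) (ρ 1) (ρ 2) (ρ 3) h12 h13 h23 l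
    rw [row_add, row_add, row_add, hkb.2, row_rowAt_self, row_rowAt_ne h23, add_zero, add_zero,
      T3_add₃, e0, zero_add, hsec u, T3_swap₂₃] at e1
    rw [hφu]; exact e1
  have hχ : ∀ u, ∃ μ : K, χ u = μ • lvec j c α (-β) := hPA j c α β χ hjc hαβ hTa
  have hφ : ∀ u, ∃ μ : K, φ u = μ • lvec j c α β := by
    have hαβ' : α ≠ 0 ∨ -β ≠ 0 := hαβ.imp id fun h => neg_ne_zero.mpr h
    have := hPA j c α (-β) φ hjc hαβ' hTb
    simpa only [neg_neg] using this
  -- membership in `W`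
  have hW : ∀ x, x ∈ W ↔ (row x 0 = 0 ∧ (∃ s : K, row x (ρ 2) = s • lvec j c α β) ∧
      (∃ t : K, row x (ρ 3) = t • lvec j c α (-β))) := by
    intro x
    constructor
    · intro hx
      have hk := (hK (x - (g (row x (ρ 1)) : Fin 4 × Fin 4 → K))).mp
        ⟨W.sub_mem hx (hgW _), by rw [row_sub, hsec, sub_self]⟩
      obtain ⟨-, ⟨μ, hμ⟩, ⟨ν, hν⟩⟩ := hk
      obtain ⟨μ', hμ'⟩ := hφ (row x (ρ 1))
      obtain ⟨ν', hν'⟩ := hχ (row x (ρ 1))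
      rw [row_sub, sub_eq_iff_eq_add] at hμ hν
      refine ⟨h0 x hx, ⟨μ + μ', ?_⟩, ⟨ν + ν', ?_⟩⟩
      · rw [hμ, ← hφu (row x (ρ 1)), hμ', add_smul]
      · rw [hν, ← hχu (row x (ρ 1)), hν', add_smul]
    · rintro ⟨hx0, ⟨s, hs⟩, ⟨t, ht⟩⟩
      obtain ⟨μ', hμ'⟩ := hφ (row x (ρ 1))
      obtain ⟨ν', hν'⟩ := hχ (row x (ρ 1))
      have hk : x - (g (row x (ρ 1)) : Fin 4 × Fin 4 → K) ∈ W := by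
        refine ((hK _).mpr ⟨fun i hi2 hi3 => ?_, ⟨s - μ', ?_⟩, ⟨t - ν', ?_⟩⟩).1
        · rcases fin4_of_perm ρ i with rfl | rfl | rfl | rfl
          · rw [hρ, row_sub, hx0, h0 _ (hgW _), sub_zero]
          · rw [row_sub, hsec, sub_self]
          · exact absurd rfl hi2
          · exact absurd rfl hi3
        · rw [row_sub, hs, ← hφu (row x (ρ 1)), hμ', sub_smul]
        · rw [row_sub, ht, ← hχu (row x (ρ 1)), hν', sub_smul]
      have := W.add_mem hk (hgW (row x (ρ 1)))
      rwa [sub_add_cancel] at this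
  -- conclusion: a cross when `αβ = 0`, `V_λ` otherwise
  by_cases hβ : β = 0
  · subst hβ
    refine Or.inr ⟨ρ 1, j, fun x hx i j' hi hj' => ?_⟩
    obtain ⟨hx0, ⟨s, hs⟩, ⟨t, ht⟩⟩ := (hW x).mp hx
    rcases fin4_of_perm ρ i with rfl | rfl | rfl | rfl
    · rw [hρ]; exact congrFun hx0 j'
    · exact absurd rfl hi
    · have e := congrFun hs j'
      simp only [row, Pi.smul_apply, smul_eq_mul, lvec_apply, if_neg hj'] at e
      simpa using e
    · have e := congrFun ht j'
      simp only [row, Pi.smul_apply, smul_eq_mul, lvec_apply, if_neg hj'] at e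
      simpa using e
  by_cases hα : α = 0
  · subst hα
    refine Or.inr ⟨ρ 1, c, fun x hx i j' hi hj' => ?_⟩
    obtain ⟨hx0, ⟨s, hs⟩, ⟨t, ht⟩⟩ := (hW x).mp hx
    rcases fin4_of_perm ρ i with rfl | rfl | rfl | rfl
    · rw [hρ]; exact congrFun hx0 j'
    · exact absurd rfl hi
    · have e := congrFun hs j'
      simp only [row, Pi.smul_apply, smul_eq_mul, lvec_apply, if_neg hj'] at e
      simpa using e
    · have e := congrFun ht j'
      simp only [row, Pi.smul_apply, smul_eq_mul, lvec_apply, if_neg hj'] at e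
      simpa using e
  · obtain ⟨γ, hγ0, hγ1⟩ := exists_perm_zero_one hjc
    refine Or.inl ⟨ρ, γ, α, β, hα, hβ, fun x => (hW x).trans ?_⟩
    refine and_congr ?_ (and_congr (exists_congr fun s => ?_) (exists_congr fun t => ?_))
    · rw [hρ]; exact funext_iff
    · constructor
      · intro h j'
        have e := congrFun h (γ j')
        rw [Pi.smul_apply, smul_eq_mul, lvec_perm hjc hγ0 hγ1] at e
        exact e
      · intro h
        funext j''
        obtain ⟨j', rfl⟩ := γ.surjective j''
        rw [Pi.smul_apply, smul_eq_mul, lvec_perm hjc hγ0 hγ1]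
        exact h j'
    · constructor
      · intro h j'
        have e := congrFun h (γ j')
        rw [Pi.smul_apply, smul_eq_mul, lvec_perm hjc hγ0 hγ1] at e
        exact e
      · intro h
        funext j''
        obtain ⟨j', rfl⟩ := γ.surjective j''
        rw [Pi.smul_apply, smul_eq_mul, lvec_perm hjc hγ0 hγ1]
        exact h j'

/-- Auxiliary: `rowAt_apply_self` (val-idea-18, SING-SIX classification). [folklore] -/
@[simp] theorem rowAt_apply_self (r : Fin 4) (v : Fin 4 → K) (i : Fin 4) : rowAt r v (r, i) = v i := by
  simp [rowAt]

/-- Auxiliary: `rowAt_apply_ne` (val-idea-18, SING-SIX classification). [folklore] -/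
theorem rowAt_apply_ne {r p : Fin 4} (h : p ≠ r) (v : Fin 4 → K) (i : Fin 4) :
    rowAt r v (p, i) = 0 := by
  simp [rowAt, h]

/-- Auxiliary: `flipAt_apply_self` (val-idea-18, SING-SIX classification). [folklore] -/
theorem flipAt_apply_self (c : Fin 4) (v : Fin 4 → K) : flipAt c v c = -v c := by
  simp [flipAt]

/-- Auxiliary: `flipAt_apply_ne` (val-idea-18, SING-SIX classification). [folklore] -/
theorem flipAt_apply_ne {c i : Fin 4} (h : i ≠ c) (v : Fin 4 → K) : flipAt c v i = v i := by
  simp [flipAt, h]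

/-- The graph-plane conditions on rows `r, s` (columns `j, c`, ratio `e`): rows `r, s` supported on
columns `j, c`, `y_{s j} = e y_{r j}`, `y_{s c} = -e y_{r c}`. -/
def GraphCond (r s j c : Fin 4) (e : K) (y : Fin 4 × Fin 4 → K) : Prop :=
  (∀ i, i ≠ j → i ≠ c → y (r, i) = 0 ∧ y (s, i) = 0) ∧
    y (s, j) = e * y (r, j) ∧ y (s, c) = -(e * y (r, c))

/-- Auxiliary: `graphCond_add` (val-idea-18, SING-SIX classification). [folklore] -/
theorem graphCond_add {r s j c : Fin 4} {e : K} {y z : Fin 4 × Fin 4 → K}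
    (hy : GraphCond r s j c e y) (hz : GraphCond r s j c e z) : GraphCond r s j c e (y + z) := by
  obtain ⟨hy0, hyj, hyc⟩ := hy
  obtain ⟨hz0, hzj, hzc⟩ := hz
  refine ⟨fun i hij hic => ⟨?_, ?_⟩, ?_, ?_⟩
  · rw [Pi.add_apply, (hy0 i hij hic).1, (hz0 i hij hic).1, add_zero]
  · rw [Pi.add_apply, (hy0 i hij hic).2, (hz0 i hij hic).2, add_zero]
  · simp only [Pi.add_apply]; rw [hyj, hzj]; ring
  · simp only [Pi.add_apply]; rw [hyc, hzc]; ring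

/-- Auxiliary: `graphCond_sub` (val-idea-18, SING-SIX classification). [folklore] -/
theorem graphCond_sub {r s j c : Fin 4} {e : K} {y z : Fin 4 × Fin 4 → K}
    (hy : GraphCond r s j c e y) (hz : GraphCond r s j c e z) : GraphCond r s j c e (y - z) := by
  obtain ⟨hy0, hyj, hyc⟩ := hy
  obtain ⟨hz0, hzj, hzc⟩ := hz
  refine ⟨fun i hij hic => ⟨?_, ?_⟩, ?_, ?_⟩
  · rw [Pi.sub_apply, (hy0 i hij hic).1, (hz0 i hij hic).1, sub_zero]
  · rw [Pi.sub_apply, (hy0 i hij hic).2, (hz0 i hij hic).2, sub_zero]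
  · simp only [Pi.sub_apply]; rw [hyj, hzj]; ring
  · simp only [Pi.sub_apply]; rw [hyc, hzc]; ring

end Summit.ValiantsHypothesis.ValiantsHypothesis.Theorems.SymPencilSingSixClassification

end
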